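import Summits.Ventures.HodgeRepro2.T6N41Hyp
import Summits.Ventures.HodgeRepro2.T6N41Primes
import Summits.Ventures.HodgeRepro2.T6N41Main

/-!
# T6N41MainE — THEOREM N4.1 in kernel with the Hecke L-functions as Iwasawa prints them: `N41_mainE` (M2; proof lane)

`T6N41Main.N41_main` (p401217) consumes the v1 display `Iwasawa2019_Sec3_1_EulerProduct` whose Euler factors are
indexed by the PLACES of `F` with ONE factor `(1 − a_v q_v^{−s})⁻¹` per place — not Iwasawa's shape at a place of
`F` that splits in `E` (two prime ideals above it, two factors).  `N41_mainE` is the same theorem with the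
faithful display `Iwasawa2019_Sec3_1_EulerProductE` (the product over the prime ideals `𝔓` of `E`, absolutely and
unconditionally convergent for `Re s > 1`, the datum's per-place factor `g v` being the finite product over the
primes `𝔓 | v`), through the regrouping of `T6N41Primes`.  THIS is the theorem the M2 composition consumes
(`N4_main : M.iA ∧ M.iB`); `N41_main` stays in the tree as the one-prime-per-place special case.

Binders: the six displays BY NAME (GQT Thm 11.4(ii); Lapid–Rallis §10 ×2; Iwasawa §3.1 (E) / Thm 3.1 / Prop. 4.4,
the last three for both characters), the two composition inputs `harch` (t6-p6's archimedean factors through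
`T6N41Arch`) and `hunr` (the placement (P7), the lead's (q4)), and `(H_loc)`.  Conclusion: (R1) and both
characters non-trivial.  `#print axioms` = {propext, Classical.choice, Quot.sound}.

§8(d): uses an L-value-free non-vanishing device: NO.
-/

namespace Summit.Ventures.HodgeRepro2.T6
namespace N41Main

open DoublingLDatum N41Core

/-- The per-place Hecke factor of the faithful display is the finite product of the single factors over the primes
above `v`: `g v = fun s => ∏ 𝔓 ∈ T_v, (1 − a 𝔓 q_𝔓^{−s})⁻¹` with `T_v` the (finite) fibre. -/
theorem fiber_eq_finset_prod {ι : Type*} {κ : Type} (b : κ → ι) (a : κ → ℂ) (q : κ → ℝ)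
    {g : ι → ℂ → ℂ} (hfin : ∀ v, (b ⁻¹' {v}).Finite)
    (hfib : ∀ v (s : ℂ), HasProd (fun 𝔓 : {𝔓 // b 𝔓 = v} => (1 - a 𝔓 * (q 𝔓 : ℂ) ^ (-s))⁻¹) (g v s))
    (v : ι) :
    g v = fun s : ℂ => ∏ 𝔓 ∈ (hfin v).toFinset, (1 - a 𝔓 * (q 𝔓 : ℂ) ^ (-s))⁻¹ := by
  funext s
  let e : {𝔓 // b 𝔓 = v} ≃ ↥(((hfin v).toFinset : Finset κ) : Set κ) :=
    Equiv.subtypeEquivRight fun 𝔓 => by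
      rw [Finset.mem_coe, Set.Finite.mem_toFinset, Set.mem_preimage, Set.mem_singleton_iff]
  have h1' : HasProd (fun 𝔓 : {𝔓 // b 𝔓 = v} => (1 - a 𝔓 * (q 𝔓 : ℂ) ^ (-s))⁻¹)
      (∏ 𝔓 ∈ (hfin v).toFinset, (1 - a 𝔓 * (q 𝔓 : ℂ) ^ (-s))⁻¹) := by
    have h1 := (Equiv.hasProd_iff e).2 (hasProd_finset_subtype (hfin v).toFinset
      (fun 𝔓 => (1 - a 𝔓 * (q 𝔓 : ℂ) ^ (-s))⁻¹))
    convert h1 using 1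
    funext 𝔓
    rfl
  exact (hfib v s).unique h1'

/-- The `hg` binder of `R1_of_eulerProductsE` at `x = 1`, `σ₀ = 1` from the faithful display: the inverse of the
per-place factor is the finite product of the entire functions `1 − a 𝔓 q_𝔓^{−s}`, non-zero at `1` and on
`Re s > 1`. -/
theorem hecke_hypE {ι : Type*} {L : ℂ → ℂ} {g : ι → ℂ → ℂ}
    (h : Hyp.Iwasawa2019_Sec3_1_EulerProductE L g) (v : ι) :
    AnalyticOnNhd ℂ (g v)⁻¹ Set.univ ∧ (g v)⁻¹ 1 ≠ 0 ∧ ∀ s : ℂ, (1 : ℝ) < s.re → g v s ≠ 0 := by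
  obtain ⟨κ, b, a, q, ha, hq, hfin, hfib, -⟩ := h
  rw [fiber_eq_finset_prod b a q hfin hfib v]
  have hinv : (fun s : ℂ => ∏ 𝔓 ∈ (hfin v).toFinset, (1 - a 𝔓 * (q 𝔓 : ℂ) ^ (-s))⁻¹)⁻¹ =
      ∏ 𝔓 ∈ (hfin v).toFinset, (fun s : ℂ => 1 - a 𝔓 * (q 𝔓 : ℂ) ^ (-s)) := by
    funext s
    simp only [Pi.inv_apply, Finset.prod_inv_distrib, inv_inv, Finset.prod_apply]
  refine ⟨?_, ?_, fun s hs => ?_⟩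
  · rw [hinv]
    exact Finset.analyticOnNhd_prod _ fun 𝔓 _ y _ =>
      analyticAt_one_sub_mul_cpow (a 𝔓) (zero_lt_one.trans (hq 𝔓)) y
  · rw [hinv, Finset.prod_apply, Finset.prod_ne_zero_iff]
    intro 𝔓 _
    exact one_sub_mul_cpow_ne_zero (ha 𝔓) (hq 𝔓) (by simp)
  · rw [Finset.prod_ne_zero_iff]
    intro 𝔓 _
    exact inv_ne_zero (one_sub_mul_cpow_ne_zero (ha 𝔓) (hq 𝔓) (zero_lt_one.trans hs))

/-- **THEOREM N4.1 (a)+(b) in kernel, faithful Hecke displays.** For the datum `D` of a cuspidal `π` (side A or side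
B) and the set `A` of archimedean places: assuming the displays — GQT Thm 11.4(ii), Lapid–Rallis §10 (the global
L-function and the `p`-adic factors), Iwasawa §3.1 (the Euler product over the primes of `E`) / Thm 3.1 / Prop. 4.4
for both Hecke characters — the composition inputs `harch` (archimedean factors zero-free at `1`) and `hunr` (the
unramified identity off `S`), and `(H_loc)`: `L(s, π × χ_V)` is holomorphic at `s = 1` with `L(1, π × χ_V) ≠ 0`,
and `η₁′ ≢ 1`, `η₂′ ≢ 1`. -/
theorem N41_mainE {ι : Type*} (D : DoublingLDatum ι) (A : Finset ι)
    (hGQT : Hyp.GQT2014_Thm11_4_ii D)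
    (hLR : Hyp.LapidRallis2005_Sec10_GlobalL D)
    (hpadic : Hyp.LapidRallis2005_Sec10_padic D A)
    (hI₁e : Hyp.Iwasawa2019_Sec3_1_EulerProductE D.L₁ D.g₁)
    (hI₂e : Hyp.Iwasawa2019_Sec3_1_EulerProductE D.L₂ D.g₂)
    (hI₁ : Hyp.Iwasawa2019_Thm3_1 D.L₁ D.triv₁) (hI₂ : Hyp.Iwasawa2019_Thm3_1 D.L₂ D.triv₂)
    (hP₁ : Hyp.Iwasawa2019_Prop4_4 D.L₁ D.triv₁) (hP₂ : Hyp.Iwasawa2019_Prop4_4 D.L₂ D.triv₂)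
    (harch : ∀ v ∈ A, MeromorphicOn (D.Lv v) Set.univ ∧ meromorphicOrderAt (D.Lv v) 1 ≤ 0)
    (hunr : ∀ v ∉ D.S, ∀ s : ℂ, D.Lv v s = D.g₁ v s * D.g₂ v s)
    (hloc : D.Hloc) : D.R1 ∧ D.BothNontrivial := by
  have hg₁ := fun v (_ : v ∈ D.S) => hecke_hypE hI₁e v
  have hg₂ := fun v (_ : v ∈ D.S) => hecke_hypE hI₂e v
  obtain ⟨κ₁, b₁, a₁, q₁, -, -, -, hfib₁, he₁⟩ := hI₁e
  obtain ⟨κ₂, b₂, a₂, q₂, -, -, -, hfib₂, he₂⟩ := hI₂e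
  have hmain := R1_of_eulerProductsE D.S D.Lv D.g₁ D.g₂ D.L D.L₁ D.L₂ b₁ b₂
    (fun 𝔓 s => (1 - a₁ 𝔓 * (q₁ 𝔓 : ℂ) ^ (-s))⁻¹) (fun 𝔓 s => (1 - a₂ 𝔓 * (q₂ 𝔓 : ℂ) ^ (-s))⁻¹)
    (σ₀ := 1) (x := 1) (η₁triv := D.triv₁) (η₂triv := D.triv₂) hLR.1 hfib₁ hfib₂ he₁ he₂
    hLR.2 hI₁.1 hI₂.1 hunr
    (fun v hv => by
      by_cases hvA : v ∈ A
      · exact harch v hvA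
      · exact padic_hyp D A hpadic hv hvA 1)
    hg₁ hg₂
    (fun h => (hI₁.2.2 h).1)
    (fun h => ⟨hI₁.2.1 h 1 trivial, by simpa using hP₁ 0 (Or.inl h)⟩)
    (fun h => (hI₂.2.2 h).1)
    (fun h => ⟨hI₂.2.1 h 1 trivial, by simpa using hP₂ 0 (Or.inl h)⟩)
    (hGQT hloc)
  exact ⟨hmain.1, hmain.2.1, hmain.2.2.1⟩

end N41Main
end Summit.Ventures.HodgeRepro2.T6
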